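import Summits.Ventures.HodgeRepro.Groups
import Summits.Ventures.HodgeRepro.RouteCClauses

/-!
# The degree-6 face table for closer C5′, sealed row `Sextic.Cyclic` (`G = C6`, `c = cc_C6`): every
# sealed representative as a `FaceData` with its class decomposition, certified by `decide`, and discharged

Blind re-derivation cell `pub-hodge-repro`, seat `night-1`.  GENERATED by `bin/gen_faces6.py` from the sealed
`FaceCensusRows8.lean` (namespace `Sextic.Cyclic`: Cayley table, `conj = 3`, `reps`), read in typer's model
(`Groups.lean`) through the sealed dictionary `enum` (bit `i` of a mask ↔ the group element `enum i`).  For each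
representative `(Φ; π, π′)`: the corners are sorted into right-translation classes (isogeny classes of the
corner varieties), with representatives `reps`, class map `cls`, twists `tw` (`T i = reps (cls i) · tw i`) and
the orders of the right stabilisers (`A_{reps k} ∼ Simple^{stabOrder k}`, `dim Simple = 6 / (2 · stabOrder)`).
`FaceData.Ok` + `StabOrderOk` are ONE `decide` each; the discharge is the generic `FaceData.weilAlgebraic` at
`p = max(6, g)`, `g = dim B_red`.  The table (`g`, `p`, stabiliser orders = the reflex-field degrees `[E : M′_μ]`
of the Liu types, `reflexStab_liuType`):

* face 0: sealed `(7, 9, 18)` — classes 2, stabiliser orders `[1, 3]`, simple dims `[3, 1]`, `g = 4`, `p = 6` (BMM range at its boundary `3k = p`)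

Nothing here says anything about the status of the Hodge conjecture for CM abelian varieties, which is NOT proved.
-/

open Finset
open scoped Pointwise

namespace HodgeRepro.RouteC

namespace Faces6Cyclic

/-- The elements of `C6` through the sealed dictionary `enum`. -/
abbrev σ (i : ZMod 6) : C6 := Multiplicative.ofAdd i

/-! ### Face 0: sealed representative `(7, 9, 18)` -/

/-- Face 0: `Φ = {σ 0, σ 1, σ 2}` (mask `7`), places of `σ 0` (mask `9`) and `σ 1` (mask `18`);
corners `['{σ 0, σ 1, σ 2}', '{σ 0, σ 4, σ 5}', '{σ 1, σ 3, σ 5}', '{σ 2, σ 3, σ 4}']`; classes `2`, stabiliser orders `[1, 3]`. -/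
def face0 : FaceData C6 where
  Φ := {σ 0, σ 1, σ 2}
  p := σ 0
  p' := σ 1
  J := 2
  reps := ![{σ 0, σ 1, σ 2}, {σ 1, σ 3, σ 5}]
  cls := ![0, 0, 1, 0]
  tw := ![σ 0, σ 4, σ 0, σ 2]
  stabOrder := ![1, 3]

/-- Face 0: the decidable checks. -/
theorem face0_ok : (face0).Ok cc_C6 := by decide

/-- Face 0: the stabiliser orders `[1, 3]`. -/
theorem face0_stab : (face0).StabOrderOk := by decide

/-- Face 0: `g = dim B_red = 4`. -/
theorem face0_dim : (face0).dimBred = 4 := by decide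

/-- Face 0 discharged by C5′ at `p = 6` from the printed clauses (`Clauses 6 2`). -/
theorem face0_weilAlgebraic (V : Vocab C6 cc_C6) (H : V.Clauses 6 2) :
    V.WeilAlgebraic ((face0).face cc_C6) :=
  (face0).weilAlgebraic cc_C6 cc_C6_isComplexConj V face0_ok face0_stab (by decide) (le_of_eq_of_le face0_dim (by decide))
    (by norm_num) H

end Faces6Cyclic

end HodgeRepro.RouteC
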